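import Mathlib
import Literature.Analysis.FluidPDE.Tao2016AveragedNS.ShiftSetCascadeFlows
import Summits.NavierStokesRegularity.NavierStokesRegularity.Theorems.TaoLadderRungTwoFlatQuadPolarOn
import Summits.NavierStokesRegularity.NavierStokesRegularity.Theorems.TaoLadderRungTwoFlatLinearisedUniqueness
import Summits.NavierStokesRegularity.NavierStokesRegularity.Theorems.TaoLadderRungTwoFlatLinearisedGronwall
import Summits.NavierStokesRegularity.NavierStokesRegularity.Theorems.TaoLadderRungTwoFlatFlowContinuity
import HarnessLib

/-!
# Duhamel–Gronwall bound for the FORCED linearised lattice equation and continuity of exact solutions in the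
  TABLE (any shift set, scale ratio 1)
  (helper for item stmt-NavierStokesRegularity-22987 `FlatGapCertificatesV2`, crux K_A♭ of route
  TaoLadderRungTwoFlat; cell harvest/h2-tao-ladder, p1 g19)

* `abs_le_forced_majorant`, `abs_le_forced_exp` — a solution of `u̇ = Lin_Φ(u) + f`, `|f| ≤ F` on `[0,T]`, bounded
  on `[0,T]`, `|u(0)| ≤ B`, along a continuous background `|Φ| ≤ M_Φ`, obeys
  `|u_{i,n}(s)| ≤ (B + F s)·exp(2‖α‖₁ M_Φ s)` (Picard majorants with forcing). This is the workhorse for every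
  perturbative comparison in the transfer plan: deviation vs. variational solution (forcing `Q(η)`), and
  dependence on the table / on the scale ratio (forcing `Q_{α̃−α}`).
* `quadTermOn_sub_table` — the field is LINEAR in the table: `Q_α(X) − Q_β(X) = Q_{α−β}(X)`;
  `abs_quadTermOn_zero_le_tableAbsSum` — `|Q_γ(X)| ≤ ‖γ‖₁ M²`.
* `abs_sub_le_of_tables` — **two exact global solutions with the SAME data but DIFFERENT tables `α, β`, both bounded
  by `M` on `[0, T]`, stay within `‖α − β‖₁ M² s · exp(2‖α‖₁ M s)` of each other**: continuity of the homogeneous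
  lattice flow in the table. With `…RenormFrame` (graded lattice at ratio `1+ε₀` = homogeneous lattice of the
  renormalised table `α̃ = α + O(ε₀)`) this is the continuity of the K_A♭ dynamics AT `ε₀ = 0`, over any fixed
  number of hops.

HONEST FRAMING: elementary real analysis for a MODEL lattice; nothing certified; nothing about the Navier–Stokes
equations.
-/

noncomputable section

-- the sub-problem namespace repeats the summit name by design (D-0017)
set_option linter.dupNamespace false

namespace Summit.NavierStokesRegularity.NavierStokesRegularity.Theorems

open Set Filter Literature.Analysis.FluidPDE Literature.Analysis.FluidPDE.TaoCascade
open scoped Topology Nat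

namespace QuadPolar

variable {m : ℕ}

/-! ### The forced linear equation -/

/-- **Picard majorants with forcing.** For `u̇ = Lin_Φ(u) + f` with `|f| ≤ F` on `[0, T]` (`F ≥ 0`), `|u(0)| ≤ B`,
`u` bounded by `M_u` on `[0,T]`, continuous background `|Φ| ≤ M_Φ`, continuous `f`: for every `j`,
`|u_{i,n}(s)| ≤ (B + F s)·Σ_{l<j}(Ls)^l/l! + M_u (Ls)^j/j!` on `[0, T]` (`L = 2‖α‖₁ M_Φ`).
[cite: Tao2016AveragedNS, §4 (4.8); folklore (Picard iteration)] -/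
theorem abs_le_forced_majorant (𝕊 : Finset (ℤ × ℤ × ℤ)) (α : Fin m → Fin m → Fin m → ℤ × ℤ × ℤ → ℝ)
    {Φ u f : Fin m → ℤ → ℝ → ℝ} {MΦ Mu B F T : ℝ} (hΦc : ∀ j k, Continuous (Φ j k))
    (hΦ : ∀ j k t, |Φ j k t| ≤ MΦ) (hfc : ∀ j k, Continuous (f j k))
    (hf : ∀ j k, ∀ t ∈ Icc 0 T, |f j k t| ≤ F) (hF : 0 ≤ F)
    (hder : ∀ i n t, HasDerivAt (u i n) (linTermOn 𝕊 0 α Φ u i n t + f i n t) t)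
    (hbdd : ∀ i n, ∀ t ∈ Icc 0 T, |u i n t| ≤ Mu) (hB : ∀ i n, |u i n 0| ≤ B) :
    ∀ (j : ℕ) (i : Fin m) (n : ℤ), ∀ s ∈ Icc 0 T,
      |u i n s| ≤ (B + F * s) * ∑ l ∈ Finset.range j, (2 * tableAbsSum 𝕊 α * MΦ * s) ^ l / l ! +
        Mu * (2 * tableAbsSum 𝕊 α * MΦ * s) ^ j / j ! := by
  set L := 2 * tableAbsSum 𝕊 α * MΦ with hL
  have huc : ∀ j k, Continuous (u j k) := fun j k =>
    continuous_iff_continuousAt.2 fun t => (hder j k t).continuousAt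
  have hLc : ∀ i n, Continuous fun t => linTermOn 𝕊 0 α Φ u i n t + f i n t :=
    fun i n => (continuous_linTermOn 𝕊 0 α hΦc huc i n).add (hfc i n)
  intro j
  induction j with
  | zero =>
    intro i n s hs
    simpa using hbdd i n s hs
  | succ j ih =>
    intro i n s hs
    have hs0 : 0 ≤ s := hs.1
    have hMΦ : 0 ≤ MΦ := (abs_nonneg _).trans (hΦ i n 0)
    have hL0 : 0 ≤ L := by rw [hL]; have := tableAbsSum_nonneg 𝕊 α; positivity
    have hB0 : 0 ≤ B := (abs_nonneg _).trans (hB i n)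
    have hftc : ∫ σ in (0 : ℝ)..s, (linTermOn 𝕊 0 α Φ u i n σ + f i n σ) = u i n s - u i n 0 :=
      intervalIntegral.integral_eq_sub_of_hasDerivAt (fun σ _ => hder i n σ) ((hLc i n).intervalIntegrable _ _)
    -- pointwise bound of the integrand on [0, s]: F + L × (level-j bound at σ), then σ ≤ s inside the bracket
    have hpt : ∀ σ ∈ Icc 0 s, |linTermOn 𝕊 0 α Φ u i n σ + f i n σ| ≤
        F + L * ((B + F * s) * ∑ l ∈ Finset.range j, (L * σ) ^ l / l ! + Mu * (L * σ) ^ j / j !) := by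
      intro σ hσ
      have hσT : σ ∈ Icc 0 T := ⟨hσ.1, hσ.2.trans hs.2⟩
      have hb := abs_linTermOn_zero_le 𝕊 α (fun j' k => hΦ j' k σ) (fun j' k => ih j' k σ hσT) i n
      have hsum0 : 0 ≤ ∑ l ∈ Finset.range j, (L * σ) ^ l / (l ! : ℝ) :=
        Finset.sum_nonneg fun l _ => by have := hσ.1; positivity
      have hmono : (B + F * σ) * ∑ l ∈ Finset.range j, (L * σ) ^ l / l ! ≤
          (B + F * s) * ∑ l ∈ Finset.range j, (L * σ) ^ l / l ! :=
        mul_le_mul_of_nonneg_right (by nlinarith [hσ.2]) hsum0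
      calc |linTermOn 𝕊 0 α Φ u i n σ + f i n σ|
          ≤ |linTermOn 𝕊 0 α Φ u i n σ| + |f i n σ| := abs_add_le _ _
        _ ≤ 2 * tableAbsSum 𝕊 α * MΦ *
              ((B + F * σ) * ∑ l ∈ Finset.range j, (L * σ) ^ l / l ! + Mu * (L * σ) ^ j / j !) + F :=
            add_le_add hb (hf i n σ hσT)
        _ ≤ F + L * ((B + F * s) * ∑ l ∈ Finset.range j, (L * σ) ^ l / l ! + Mu * (L * σ) ^ j / j !) := by
            rw [← hL]; nlinarith [mul_le_mul_of_nonneg_left hmono hL0]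
    have hmaj2 : Continuous fun σ : ℝ =>
        L * ((B + F * s) * ∑ l ∈ Finset.range j, (L * σ) ^ l / l ! + Mu * (L * σ) ^ j / j !) := by
      refine continuous_const.mul (Continuous.add ?_ ?_)
      · exact continuous_const.mul (continuous_finsetSum _ fun l _ =>
          ((continuous_const.mul continuous_id).pow l).div_const _)
      · exact (continuous_const.mul ((continuous_const.mul continuous_id).pow j)).div_const _
    have hmaj_cont : Continuous fun σ : ℝ =>
        F + L * ((B + F * s) * ∑ l ∈ Finset.range j, (L * σ) ^ l / l ! + Mu * (L * σ) ^ j / j !) :=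
      continuous_const.add hmaj2
    have hI : ∫ σ in (0 : ℝ)..s,
        (F + L * ((B + F * s) * ∑ l ∈ Finset.range j, (L * σ) ^ l / l ! + Mu * (L * σ) ^ j / j !)) =
        F * s + ((B + F * s) * ∑ l ∈ Finset.range j, (L * s) ^ (l + 1) / (l + 1)! +
          Mu * (L * s) ^ (j + 1) / (j + 1)!) := by
      rw [intervalIntegral.integral_add intervalIntegrable_const (hmaj2.intervalIntegrable _ _),
        intervalIntegral.integral_const, integral_majorant, smul_eq_mul, sub_zero, mul_comm s F]
    have hu_eq : u i n s = u i n 0 + ∫ σ in (0 : ℝ)..s, (linTermOn 𝕊 0 α Φ u i n σ + f i n σ) := by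
      rw [hftc]; ring
    calc |u i n s| = |u i n 0 + ∫ σ in (0 : ℝ)..s, (linTermOn 𝕊 0 α Φ u i n σ + f i n σ)| := by rw [← hu_eq]
      _ ≤ |u i n 0| + |∫ σ in (0 : ℝ)..s, (linTermOn 𝕊 0 α Φ u i n σ + f i n σ)| := abs_add_le _ _
      _ ≤ B + ∫ σ in (0 : ℝ)..s, |linTermOn 𝕊 0 α Φ u i n σ + f i n σ| :=
          add_le_add (hB i n) (intervalIntegral.abs_integral_le_integral_abs hs0)
      _ ≤ B + ∫ σ in (0 : ℝ)..s,
            (F + L * ((B + F * s) * ∑ l ∈ Finset.range j, (L * σ) ^ l / l ! + Mu * (L * σ) ^ j / j !)) := by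
          gcongr
          exact intervalIntegral.integral_mono_on hs0 (((hLc i n).abs).intervalIntegrable _ _)
            (hmaj_cont.intervalIntegrable _ _) hpt
      _ = B + (F * s + ((B + F * s) * ∑ l ∈ Finset.range j, (L * s) ^ (l + 1) / (l + 1)! +
            Mu * (L * s) ^ (j + 1) / (j + 1)!)) := by rw [hI]
      _ = (B + F * s) * ∑ l ∈ Finset.range (j + 1), (L * s) ^ l / l ! + Mu * (L * s) ^ (j + 1) / (j + 1)! := by
          rw [Finset.sum_range_succ' (fun l => (L * s) ^ l / (l ! : ℝ))]
          simp only [pow_zero, Nat.factorial_zero, Nat.cast_one, div_one]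
          ring

/-- **DUHAMEL–GRONWALL BOUND for the forced linearised equation** (scale ratio `1`): under the hypotheses of
`abs_le_forced_majorant`, `|u_{i,n}(s)| ≤ (B + F s)·exp(2‖α‖₁ M_Φ s)` on `[0, T]`.
[cite: Tao2016AveragedNS, §4 (4.8); folklore (Gronwall)] -/
theorem abs_le_forced_exp (𝕊 : Finset (ℤ × ℤ × ℤ)) (α : Fin m → Fin m → Fin m → ℤ × ℤ × ℤ → ℝ)
    {Φ u f : Fin m → ℤ → ℝ → ℝ} {MΦ Mu B F T : ℝ} (hΦc : ∀ j k, Continuous (Φ j k))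
    (hΦ : ∀ j k t, |Φ j k t| ≤ MΦ) (hfc : ∀ j k, Continuous (f j k))
    (hf : ∀ j k, ∀ t ∈ Icc 0 T, |f j k t| ≤ F) (hF : 0 ≤ F)
    (hder : ∀ i n t, HasDerivAt (u i n) (linTermOn 𝕊 0 α Φ u i n t + f i n t) t)
    (hbdd : ∀ i n, ∀ t ∈ Icc 0 T, |u i n t| ≤ Mu) (hB : ∀ i n, |u i n 0| ≤ B) (i : Fin m) (n : ℤ) {s : ℝ}
    (hs : s ∈ Icc 0 T) : |u i n s| ≤ (B + F * s) * Real.exp (2 * tableAbsSum 𝕊 α * MΦ * s) := by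
  set x := 2 * tableAbsSum 𝕊 α * MΦ * s with hx
  have hMΦ : 0 ≤ MΦ := (abs_nonneg _).trans (hΦ i n 0)
  have hx0 : 0 ≤ x := by rw [hx]; have := tableAbsSum_nonneg 𝕊 α; have := hs.1; positivity
  have hB0 : 0 ≤ B + F * s := by
    have := (abs_nonneg _).trans (hB i n); have := hs.1; positivity
  have hmaj : ∀ j : ℕ, |u i n s| ≤ (B + F * s) * Real.exp x + Mu * x ^ j / j ! := by
    intro j
    have h := abs_le_forced_majorant 𝕊 α hΦc hΦ hfc hf hF hder hbdd hB j i n s hs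
    have hsum : (B + F * s) * ∑ l ∈ Finset.range j, x ^ l / l ! ≤ (B + F * s) * Real.exp x :=
      mul_le_mul_of_nonneg_left (Real.sum_le_exp_of_nonneg hx0 j) hB0
    rw [← hx] at h
    linarith
  have hlim : Tendsto (fun j : ℕ => (B + F * s) * Real.exp x + Mu * x ^ j / j !) atTop
      (𝓝 ((B + F * s) * Real.exp x)) := by
    have h := (Real.summable_pow_div_factorial x).tendsto_atTop_zero
    have h2 := (h.const_mul Mu).const_add ((B + F * s) * Real.exp x)
    rw [mul_zero, add_zero] at h2
    refine h2.congr fun j => ?_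
    ring
  exact ge_of_tendsto' hlim hmaj

/-! ### Dependence on the table -/

/-- The nonlinearity is LINEAR IN THE TABLE: `Q_α(X) − Q_β(X) = Q_{α−β}(X)`. [cite: Tao2016AveragedNS, §4 (4.8)] -/
theorem quadTermOn_sub_table (𝕊 : Finset (ℤ × ℤ × ℤ)) (ε₀ : ℝ)
    (α β : Fin m → Fin m → Fin m → ℤ × ℤ × ℤ → ℝ) (X : Fin m → ℤ → ℝ → ℝ) (i : Fin m) (n : ℤ) (t : ℝ) :
    quadTermOn 𝕊 ε₀ α X i n t - quadTermOn 𝕊 ε₀ β X i n t = quadTermOn 𝕊 ε₀ (α - β) X i n t := by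
  simp only [quadTermOn, ← Finset.sum_sub_distrib, Pi.sub_apply]
  refine Finset.sum_congr rfl fun _ _ => Finset.sum_congr rfl fun _ _ => Finset.sum_congr rfl fun _ _ => ?_
  ring

/-- Size of the field at scale ratio `1` in terms of the table: `|Q_γ(X)_{i,n}(t)| ≤ ‖γ‖₁ M²` when `|X| ≤ M` at
time `t`. [cite: Tao2016AveragedNS, §4 (4.8)] -/
theorem abs_quadTermOn_zero_le_tableAbsSum (𝕊 : Finset (ℤ × ℤ × ℤ))
    (γ : Fin m → Fin m → Fin m → ℤ × ℤ × ℤ → ℝ) {X : Fin m → ℤ → ℝ → ℝ} {M : ℝ} {t : ℝ}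
    (hX : ∀ j k, |X j k t| ≤ M) (i : Fin m) (n : ℤ) :
    |quadTermOn 𝕊 0 γ X i n t| ≤ tableAbsSum 𝕊 γ * M ^ 2 := by
  rw [quadTermOn_eq_bilinOn, sq, ← mul_assoc]
  exact abs_bilinOn_zero_le 𝕊 γ hX hX i n

/-- **CONTINUITY OF EXACT SOLUTIONS IN THE TABLE** (scale ratio `1`, any shift set): two exact global solutions
with the SAME data, tables `α` and `β`, both bounded by `M` (everywhere in time), satisfy
`|X_{i,n}(s) − Y_{i,n}(s)| ≤ ‖α − β‖₁ M² s · exp(2‖α‖₁ M s)` on `[0, T]`. With the renormalised frame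
(`…Theorems.RenormFrame`: the graded lattice at ratio `1+ε₀` is the homogeneous lattice of `α̃ = α + O(ε₀)`) this is
the continuity of the K_A♭ dynamics at `ε₀ = 0` over any fixed time. [cite: Tao2016AveragedNS, §4 (4.8); folklore (Gronwall)] -/
theorem abs_sub_le_of_tables (𝕊 : Finset (ℤ × ℤ × ℤ)) (α β : Fin m → Fin m → Fin m → ℤ × ℤ × ℤ → ℝ)
    {X Y : Fin m → ℤ → ℝ → ℝ} {M T : ℝ}
    (hX : ∀ i n t, HasDerivAt (X i n) (quadTermOn 𝕊 0 α X i n t) t)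
    (hY : ∀ i n t, HasDerivAt (Y i n) (quadTermOn 𝕊 0 β Y i n t) t)
    (hXb : ∀ i n t, |X i n t| ≤ M) (hYb : ∀ i n t, |Y i n t| ≤ M) (h0 : ∀ i n, X i n 0 = Y i n 0)
    (i : Fin m) (n : ℤ) {s : ℝ} (hs : s ∈ Icc 0 T) :
    |X i n s - Y i n s| ≤ tableAbsSum 𝕊 (α - β) * M ^ 2 * s * Real.exp (2 * tableAbsSum 𝕊 α * M * s) := by
  set Ψ : Fin m → ℤ → ℝ → ℝ := (1 / 2 : ℝ) • (X + Y) with hΨ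
  set η : Fin m → ℤ → ℝ → ℝ := X - Y with hη
  set f : Fin m → ℤ → ℝ → ℝ := fun j k t => quadTermOn 𝕊 0 (α - β) Y j k t with hf
  have hXc : ∀ j k, Continuous (X j k) := fun j k =>
    continuous_iff_continuousAt.2 fun t => (hX j k t).continuousAt
  have hYc : ∀ j k, Continuous (Y j k) := fun j k =>
    continuous_iff_continuousAt.2 fun t => (hY j k t).continuousAt
  have hΨc : ∀ j k, Continuous (Ψ j k) := fun j k => by
    have hc : Continuous fun t => (1 / 2 : ℝ) * (X j k t + Y j k t) :=
      continuous_const.mul ((hXc j k).add (hYc j k))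
    exact hc
  have hΨb : ∀ j k t, |Ψ j k t| ≤ M := fun j k t => by
    show |(1 / 2 : ℝ) * (X j k t + Y j k t)| ≤ M
    rw [abs_mul, abs_of_pos (by norm_num : (0 : ℝ) < 1 / 2)]
    linarith [abs_add_le (X j k t) (Y j k t), hXb j k t, hYb j k t]
  have hfc : ∀ j k, Continuous (f j k) := fun j k => by
    simp only [hf, quadTermOn]
    refine continuous_finsetSum _ fun i₁ _ => continuous_finsetSum _ fun i₂ _ =>
      continuous_finsetSum _ fun μ _ => ?_
    exact continuous_const.mul ((hYc _ _).mul (hYc _ _))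
  have hfb : ∀ j k, ∀ t ∈ Icc 0 T, |f j k t| ≤ tableAbsSum 𝕊 (α - β) * M ^ 2 := fun j k t _ =>
    abs_quadTermOn_zero_le_tableAbsSum 𝕊 (α - β) (fun j' k' => hYb j' k' t) j k
  have hF : 0 ≤ tableAbsSum 𝕊 (α - β) * M ^ 2 := by
    have := tableAbsSum_nonneg 𝕊 (α - β); positivity
  -- the difference solves the forced linearised equation along Ψ with forcing f
  have hder : ∀ j k t, HasDerivAt (η j k) (linTermOn 𝕊 0 α Ψ η j k t + f j k t) t := fun j k t => by
    have e : quadTermOn 𝕊 0 α X j k t - quadTermOn 𝕊 0 β Y j k t = linTermOn 𝕊 0 α Ψ η j k t + f j k t := by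
      show quadTermOn 𝕊 0 α X j k t - quadTermOn 𝕊 0 β Y j k t =
        linTermOn 𝕊 0 α Ψ η j k t + quadTermOn 𝕊 0 (α - β) Y j k t
      rw [hΨ, hη, ← quadTermOn_sub_eq_linTermOn_mid, ← quadTermOn_sub_table]
      ring
    rw [← e]
    exact (hX j k t).sub (hY j k t)
  have hηb : ∀ j k, ∀ t ∈ Icc 0 T, |η j k t| ≤ 2 * M := fun j k t _ => by
    show |X j k t - Y j k t| ≤ 2 * M
    linarith [abs_sub (X j k t) (Y j k t), hXb j k t, hYb j k t]
  have hB : ∀ j k, |η j k 0| ≤ 0 := fun j k => by simp [hη, h0 j k]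
  have h := abs_le_forced_exp 𝕊 α hΨc hΨb hfc hfb hF hder hηb hB i n hs
  rw [zero_add] at h
  calc |X i n s - Y i n s| = |η i n s| := rfl
    _ ≤ tableAbsSum 𝕊 (α - β) * M ^ 2 * s * Real.exp (2 * tableAbsSum 𝕊 α * M * s) := h

end QuadPolar

end Summit.NavierStokesRegularity.NavierStokesRegularity.Theorems

end
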